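import Summits.QuantumAdvantage.AdviceFreeQNC0.NPGamma37Family
import HarnessLib

/-!
# Cell qa-qnc0 — rung (NP-Γ) `RingHardSparse3` (sparse-coupling hardness at `p = 3`, any degree): Part III-d — (R′) for the test rows (`resonance_poly`) and THE ASSEMBLY `sparseLoss`.

Planner qa-qnc0-p2 gen 34 (INBOX P2-34c/P2-34d, memo HOME/qa-qnc0-p2/ROUND-34P2.md §4.4); split of the kernel-checked
monolith `HOME/qa-qnc0-p2/line34/NPGammaProof37.lean` (rc 0, 0 sorries, axioms propext/Classical.choice/Quot.sound) into
≤ 400-line parts `NPGamma37{Slicing,Span,Family,Assembly,Sparse}.lean`.  Part I (𝔽₄ Kraft + sparsity) and the 𝔽₄/ℤ₃ algebra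
are IMPORTED from the landed (NP₁) files `AffBells37{Kraft,Sparse,Resonance}`, Part II (the insulator-involution resonance
MGF (R′)) from the landed `Resonance37G` — identical declarations, opened by name below.

THIS FILE: `resonance_poly` (Σ_a 2^{Zcount a} ≤ 2^n (3/2)^F via `Resonance37G.resonance_windows`), `card_loss_slice`, and
`sparseLoss`: loss ≥ 2^n / (2·2^{L(K+1)}), K = (n+1)(6+8F), under (H1′)/(H2′).

THEOREM (NP-Γ, file `NPGamma37Sparse`): for `n ≥ 200`, every strategy `P : Fin n → CubeFn (ZMod 3) n` with all outputs in
`span {mono S : S ∈ 𝓢}`, `𝓢` admitting `8·log₂ n` insulated windows (`NPGamma37.InsulatedWindows`), satisfies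
`#{x odd : Rel x (P · x = 1)} ≤ (1 − n^{−6})·2^{n−1}` — no degree hypothesis.  Supports crux stmt-QuantumAdvantage-22907
(dense coupling — the residual core of `RingHardOdd 3` — is NOT touched).
-/

noncomputable section

namespace Summit.QuantumAdvantage.AdviceFreeQNC0.NPGamma37Proof

open Finset F4
open Classical
open Summit.QuantumAdvantage.AdviceFreeQNC0.AffBells37 (expo chiZ exists_ne_one_of_mass_lt ev L sparse sparse_ne_one
  two_pow_L_le ωz ωz_zero ωz_add ωz_natCast ωz_sq lin chiZ_eq_ωz lin_add lin_mul lin_single ιF_xor ιF_decide_eq_zero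
  ιF_eq_omega ιF_ringWinU)
open Summit.QuantumAdvantage.AdviceFreeQNC0.Resonance37G (four_orbit_le orbit_mgf sg bt sg_not slope_eq no_three
  blockCpl blockCpl_blockCpl blockCpl_involutive blockCpl_apply_of_not_mem uExt_blockCpl xN xN_eq_xOfU xN_blockCpl_of_ne
  xN_blockCpl_left xN_blockCpl_right Inv letter resonance_windows)
-- `wt` (weight of a cube-restricted character) is written `AffBells37.wt` throughout: the bare name would resolve to the
-- walk-word weight `Summit.QuantumAdvantage.AdviceFreeQNC0.wt` of `Elimination.lean`.

variable {F : ℕ}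

section Slicing

open Literature.Computability.QuantumComplexity Literature.Computability.QuantumComplexity.RingHLF
open Literature.Computability.MetaComplexity
open AffBells23 AffBells26

variable {n : ℕ}
variable {N : ℕ}

/-! ### (R′) The resonance MGF of the test rows via the insulator involutions -/

/-- chain facts of an interleaved window/insulator system. -/
theorem q_mono {p q : ℕ → ℕ} (hord : ∀ j < F, q j < p j ∧ p j + 1 < q (j + 1)) :
    ∀ i j, i ≤ j → j ≤ F → q i ≤ q j := by
  intro i j hij hjF
  induction j, hij using Nat.le_induction with
  | base => exact le_rfl
  | succ j hij ih =>
    have h1 := ih (by omega)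
    have h2 := hord j (by omega)
    omega

/-- Interleaved windows `q j < p j < p j + 1 < q (j+1)` with `q F < n` form a separated free-pair system. -/
theorem sep_of_ord {p q : ℕ → ℕ} (hord : ∀ j < F, q j < p j ∧ p j + 1 < q (j + 1)) (hqF : q F < n) :
    Sep n F p := by
  refine ⟨fun j => ?_, fun j j' hjj => ?_⟩
  · have h1 := hord j.val j.isLt
    have h2 := q_mono hord (j.val + 1) F (by omega) le_rfl
    exact ⟨by omega, by omega⟩
  · have h1 := hord j.val j.isLt
    have h2 := q_mono hord (j.val + 1) j'.val (by omega) (by omega)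
    have h3 := hord j'.val j'.isLt
    omega

/-- `p j` lies strictly between `q j` and `q (j + 1)`, hence outside every insulator block of another window
and outside `[q i]`. -/
theorem p_window {p q : ℕ → ℕ} (hord : ∀ j < F, q j < p j ∧ p j + 1 < q (j + 1))
    (j j' : ℕ) (hj : j < F) (hj' : j' < F) (hne : j ≠ j') :
    p j + 1 < q j' ∨ q (j' + 1) < p j := by
  rcases Nat.lt_or_gt_of_ne hne with h | h
  · have h2 := q_mono hord (j + 1) j' (by omega) (by omega)
    have h1 := hord j hj
    omega
  · have h2 := q_mono hord (j' + 1) j (by omega) (by omega)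
    have h1 := hord j hj
    have h3 := hord j' hj'
    omega

/-- An insulator position `q i` is never a free position `p j` or `p j + 1`. -/
theorem q_ne_p {p q : ℕ → ℕ} (hord : ∀ j < F, q j < p j ∧ p j + 1 < q (j + 1))
    (i j : ℕ) (hi : i ≤ F) (hj : j < F) : q i ≠ p j ∧ q i ≠ p j + 1 := by
  by_cases h : i ≤ j
  · have h2 := q_mono hord i j h (by omega)
    have h1 := hord j hj
    omega
  · have h2 := q_mono hord (j + 1) i (by omega) hi
    have h1 := hord j hj
    omega

/-- the pattern of a block complement: flips exactly `x_s` and `x_{t+1}`. -/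
theorem xOfU_blockCpl (s t : ℕ) (hst : s ≤ t) (htn : t < n) (a : Fin n → Bool) :
    xOfU (blockCpl s t a) = flip1 (flip1 (xOfU a) s) (t + 1) := by
  funext i
  show xOfU (blockCpl s t a) i = _
  unfold flip1
  rw [← xN_eq_xOfU, ← xN_eq_xOfU]
  by_cases h2 : i.val = t + 1
  · rw [if_pos h2, if_neg (show ¬ i.val = s by omega), h2, xN_blockCpl_right s t hst htn]
  · rw [if_neg h2]
    by_cases h1 : i.val = s
    · rw [if_pos h1, h1, xN_blockCpl_left s t hst (by omega)]
    · rw [if_neg h1, xN_blockCpl_of_ne s t hst htn a i.val h1 h2]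

/-- a coefficient function `x ↦ f x` of the pattern that is invariant under the admissible flips off window `j`
and under the flips of window `j` itself is `Inv` along the insulator involutions. -/
theorem inv_of_flip {p q : ℕ → ℕ} (hord : ∀ j < F, q j < p j ∧ p j + 1 < q (j + 1)) (hqF : q F < n)
    (_j : Fin F) (f : (Fin (n + 1) → Bool) → ZMod 3)
    (hf : ∀ (x : Fin (n + 1) → Bool) (c : ℕ), Adm p q F c → f (flip1 x c) = f x) :
    Inv F p q (fun a => f (xOfU a)) := by
  intro j' hj' a
  have h1 := hord j' hj'
  have h2 := q_mono hord (j' + 1) F (by omega) le_rfl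
  constructor
  · simp only
    rw [xOfU_blockCpl (q j') (p j' - 1) (by omega) (by omega), show p j' - 1 + 1 = p j' by omega,
      hf _ _ (Or.inr ⟨⟨j', hj'⟩, Or.inl rfl⟩), hf _ _ (Or.inl ⟨j', by omega, rfl⟩)]
  · simp only
    rw [xOfU_blockCpl (p j' + 1) (q (j' + 1) - 1) (by omega) (by omega),
      show q (j' + 1) - 1 + 1 = q (j' + 1) by omega,
      hf _ _ (Or.inl ⟨j' + 1, by omega, rfl⟩), hf _ _ (Or.inr ⟨⟨j', hj'⟩, Or.inr rfl⟩)]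

/-- the coefficient functions of `P_g` in window `j` are invariant under every admissible flip. -/
theorem cA_adm {p q : ℕ → ℕ} (Q : Smolensky.CubeFn (ZMod 3) (n + 1)) (hIA : IA p q F Q) (j : Fin F)
    (x : Fin (n + 1) → Bool) (c : ℕ) (hc : Adm p q F c) :
    cA Q (p j) (p j + 1) (flip1 x c) = cA Q (p j) (p j + 1) x ∧
    cB Q (p j) (p j + 1) (flip1 x c) = cB Q (p j) (p j + 1) x ∧
    cAB Q (p j) (p j + 1) (flip1 x c) = cAB Q (p j) (p j + 1) x := by
  by_cases h : c = p j ∨ c = p j + 1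
  · exact ⟨cA_flip1_of_mem Q x h, cB_flip1_of_mem Q x h, cAB_flip1_of_mem Q x h⟩
  · push Not at h
    exact hIA j x c hc h.1 h.2

/-- the test row letter IS the `letter` of Part II with the two-bit coefficient functions. -/
theorem testRow_eq_letter {p : ℕ → ℕ} (hS : Sep n F p)
    (P : Fin (n + 1) → Smolensky.CubeFn (ZMod 3) (n + 1)) (a : Fin n → Bool) (g : Fin (n + 1)) (σ m : ZMod 3)
    (j : Fin F) :
    testRow P p a g σ m j
      = letter m (fun a => cA (P g) (p j) (p j + 1) (xOfU a)) (fun a => cB (P g) (p j) (p j + 1) (xOfU a))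
          (fun a => cAB (P g) (p j) (p j + 1) (xOfU a)) (fun a => pathRow p a g σ j) (p j) a := by
  have hp := hS.1 j
  unfold testRow rv letter
  rw [flip_sub (P g) (xOfU a) (s := p j) (t := p j + 1) (by omega) (by omega) (by omega)]
  rfl

/-- **(R′) for polynomial strategies**: `Σ_a 2^{Z_{gσm}(a)} ≤ 2ⁿ (3/2)^F`. -/
theorem resonance_poly {p q : ℕ → ℕ} (hord : ∀ j < F, q j < p j ∧ p j + 1 < q (j + 1)) (hqF : q F < n)
    (P : Fin (n + 1) → Smolensky.CubeFn (ZMod 3) (n + 1)) (hIA : ∀ g, IA p q F (P g))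
    (g : Fin (n + 1)) (σ m : ZMod 3) (hσ : σ ≠ 0) (hm : m ≠ 0) :
    (∑ a : Fin n → Bool, (2 : ℝ) ^ Zcount (F := F) P p a g σ m) ≤ (2 : ℝ) ^ n * (3 / 2 : ℝ) ^ F := by
  have hS := sep_of_ord hord hqF
  have h := resonance_windows F p q hord hqF m hm
    (fun j a => cA (P g) (p j) (p j + 1) (xOfU a)) (fun j a => cB (P g) (p j) (p j + 1) (xOfU a))
    (fun j a => cAB (P g) (p j) (p j + 1) (xOfU a)) (fun j a => pathRow p a g σ j)
    (fun j => inv_of_flip hord hqF j _ fun x c hc => (cA_adm (P g) (hIA g) j x c hc).1)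
    (fun j => inv_of_flip hord hqF j _ fun x c hc => (cA_adm (P g) (hIA g) j x c hc).2.1)
    (fun j => inv_of_flip hord hqF j _ fun x c hc => (cA_adm (P g) (hIA g) j x c hc).2.2)
    ?_ (fun j a => pathRow_ne_zero p a g hσ j)
  · refine le_of_eq_of_le ?_ h
    refine Fintype.sum_congr _ _ fun a => ?_
    unfold Zcount
    congr 2
    exact filter_congr fun j _ => by rw [testRow_eq_letter hS]
  · -- the path letter only reads `u_{p j}`, which no insulator block contains
    intro j j' hj' a
    have h1 := hord j' hj'
    have h2 := q_mono hord (j' + 1) F (by omega) le_rfl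
    have hpj := hord j.val j.isLt
    unfold pathRow
    constructor
    · simp only
      rw [uExt_blockCpl, if_neg]
      by_cases hjj : j.val = j'
      · subst hjj; omega
      · rcases p_window hord j.val j' j.isLt hj' hjj with h | h <;> omega
    · simp only
      rw [uExt_blockCpl, if_neg]
      by_cases hjj : j.val = j'
      · subst hjj; omega
      · rcases p_window hord j.val j' j.isLt hj' hjj with h | h <;> omega


/-! ### THE ASSEMBLY `sparseLoss` -/

/-- losing points seen through a slice are counted by the family. -/
theorem card_loss_slice {p : ℕ → ℕ} (hS : Sep n F p) (P : Fin (n + 1) → Smolensky.CubeFn (ZMod 3) (n + 1))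
    (hSA : ∀ g, SA (n := n) p F (P g)) (a : Fin n → Bool) :
    (univ.filter fun v : Fin F → Bool => ev univ (rows P p a) (coefs P p a) v ≠ 1).card
      = (univ.filter fun v : Fin F → Bool => Wn P (U p a v) = false).card := by
  refine congrArg Finset.card (filter_congr fun v _ => ?_)
  rw [← sliceExpansion hS P hSA a v]
  haveI := F4.nontrivial
  unfold ιF
  cases Wn P (U p a v)
  · simp
  · simp

/-- **THE SPARSE-COUPLING SLICING THEOREM** (core form): for an interleaved window/insulator system of `F`
windows in a walk of length `n ≥ 4`, a slice-affine (E1) and coefficient-invariant (E2) polynomial strategy `P`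
with `16(n+1)3^F ≤ 4^F` and `4(n+1)(1+8F) ≤ 2^F` wins at most `2ⁿ − 2ⁿ/(2·2^{L(K+1)})` odd inputs,
`K = (n+1)(6+8F)` the size of the character family. -/
theorem sparseLoss {p q : ℕ → ℕ} (hord : ∀ j < F, q j < p j ∧ p j + 1 < q (j + 1)) (hqF : q F < n) (hn : 4 ≤ n)
    (P : Fin (n + 1) → Smolensky.CubeFn (ZMod 3) (n + 1))
    (hSA : ∀ g, SA (n := n) p F (P g)) (hIA : ∀ g, IA p q F (P g))
    (h34N : 16 * (n + 1) * 3 ^ F ≤ 4 ^ F) (h2C : 4 * (n + 1) * (1 + 8 * F) ≤ 2 ^ F) :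
    (((univ.filter fun x : Fin (n + 1) → Bool => OddZeros x ∧ Rel x (zOf P x)).card : ℕ) : ℝ)
      ≤ (2 : ℝ) ^ n - (2 : ℝ) ^ n / (2 * (2 : ℝ) ^ L (Fintype.card (Ix n F) + 1)) := by
  have hS : Sep n F p := sep_of_ord hord hqF
  haveI := F4.nontrivial
  -- wins and losses of the transported game
  set Los := univ.filter (fun u : Fin n → Bool => Wn P u = false) with hLos
  have hWL : (univ.filter fun u : Fin n → Bool => Wn P u = true).card + Los.card = 2 ^ n := by
    have h := Finset.card_filter_add_card_filter_not (s := (univ : Finset (Fin n → Bool)))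
      (fun u => Wn P u = true)
    rw [card_univ, Fintype.card_fun, Fintype.card_bool, Fintype.card_fin] at h
    rw [← h, hLos]
    congr 2
    exact filter_congr fun u _ => by cases Wn P u <;> simp
  have hS1 := S1 (by omega) P
  -- masses of slices
  set K := Fintype.card (Ix n F) with hK
  set massN : (Fin n → Bool) → ℕ := fun a => ∑ b : Ix n F, 2 ^ (F - AffBells37.wt (rows P p a b)) with hmassN
  set Good := univ.filter (fun a : Fin n → Bool => massN a < 2 ^ F) with hGood
  set Bad := univ.filter (fun a : Fin n → Bool => ¬ massN a < 2 ^ F) with hBad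
  have hGB : Good.card + Bad.card = 2 ^ n := by
    rw [hGood, hBad, Finset.card_filter_add_card_filter_not, card_univ, Fintype.card_fun, Fintype.card_bool,
      Fintype.card_fin]
  -- Step A: a good slice loses `≥ 2^{Fn} / 2^{L(K+1)}` points
  set cnt : (Fin n → Bool) → ℕ := fun a => (univ.filter fun v : Fin F → Bool => Wn P (U p a v) = false).card
    with hcnt
  have hA : ∀ a ∈ Good, 2 ^ F ≤ 2 ^ L (K + 1) * cnt a := by
    intro a ha
    rw [hGood, mem_filter] at ha
    have hex := exists_ne_one_of_mass_lt F univ (rows P p a) (coefs P p a) ha.2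
    have hsp := sparse_ne_one F univ (rows P p a) (coefs P p a) hex
    rw [card_univ, ← hK, card_loss_slice hS P hSA a] at hsp
    exact hsp
  -- Step B: summing over good slices and re-randomising: `#Good ≤ 2^{L(K+1)} · #Los`
  have hsumcnt : ∑ a : Fin n → Bool, cnt a = 2 ^ F * Los.card := by
    have h1 : ∀ a, cnt a = ∑ v : Fin F → Bool, (if Wn P (U p a v) = false then 1 else 0) := by
      intro a; rw [hcnt]; exact card_filter _ _
    simp_rw [h1]
    rw [sum_comm, sum_sum_U p (fun u => if Wn P u = false then 1 else 0), hLos, card_filter]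
  have hB : Good.card ≤ 2 ^ L (K + 1) * Los.card := by
    have h1 : Good.card * 2 ^ F ≤ 2 ^ L (K + 1) * (2 ^ F * Los.card) := by
      calc Good.card * 2 ^ F = ∑ a ∈ Good, 2 ^ F := by rw [sum_const, smul_eq_mul]
        _ ≤ ∑ a ∈ Good, 2 ^ L (K + 1) * cnt a := sum_le_sum hA
        _ ≤ ∑ a, 2 ^ L (K + 1) * cnt a :=
            sum_le_sum_of_subset_of_nonneg (subset_univ _) fun _ _ _ => Nat.zero_le _
        _ = 2 ^ L (K + 1) * (2 ^ F * Los.card) := by rw [← mul_sum, hsumcnt]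
    have hpos : 0 < 2 ^ F := by positivity
    rw [show 2 ^ L (K + 1) * (2 ^ F * Los.card) = (2 ^ L (K + 1) * Los.card) * 2 ^ F by ring] at h1
    exact Nat.le_of_mul_le_mul_right h1 hpos
  -- Step C: bad slices are rare (mass bookkeeping + resonance MGF + Markov)
  set C : ℕ := 2 * (n + 1) * (1 + 8 * F) with hC
  set T : (Fin n → Bool) → ℝ := fun a => ∑ g : Fin (n + 1), ∑ σ : Bool, ∑ k : Fin 3,
      (if k = 0 then (0 : ℝ) else (2 : ℝ) ^ Zcount (F := F) P p a g (σv σ) ((k.val : ℕ) : ZMod 3)) with hT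
  have hmass : ∀ a, (massN a : ℝ) ≤ C + T a := by
    intro a
    have h := mass_rows_le (F := F) P p a
    have h' : ((massN a : ℕ) : ℝ) ≤ ((2 * (n + 1) * (1 + 8 * F) +
        ∑ g : Fin (n + 1), ∑ σ : Bool, ∑ k : Fin 3,
          (if k = 0 then 0 else 2 ^ Zcount (F := F) P p a g (σv σ) ((k.val : ℕ) : ZMod 3)) : ℕ) : ℝ) := by
      exact_mod_cast h
    have hC' : (C : ℝ) = 2 * ((n : ℝ) + 1) * (1 + 8 * (F : ℝ)) := by rw [hC]; push_cast; ring
    have hT' : T a = ∑ g : Fin (n + 1), ∑ σ : Bool, ∑ k : Fin 3,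
        (if k = 0 then (0 : ℝ) else (2 : ℝ) ^ Zcount (F := F) P p a g (σv σ) ((k.val : ℕ) : ZMod 3)) := rfl
    rw [hC', hT']
    push_cast at h'
    linarith
  have hTsum : ∑ a : Fin n → Bool, T a ≤ 4 * (n + 1) * ((2 : ℝ) ^ n * (3 / 2 : ℝ) ^ F) := by
    rw [hT, sum_comm]
    have hg : ∀ g : Fin (n + 1), ∑ a : Fin n → Bool, ∑ σ : Bool, ∑ k : Fin 3,
        (if k = 0 then (0 : ℝ) else (2 : ℝ) ^ Zcount (F := F) P p a g (σv σ) ((k.val : ℕ) : ZMod 3))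
          ≤ 4 * ((2 : ℝ) ^ n * (3 / 2 : ℝ) ^ F) := by
      intro g
      rw [sum_comm]
      have hσ : ∀ σ : Bool, ∑ a : Fin n → Bool, ∑ k : Fin 3,
          (if k = 0 then (0 : ℝ) else (2 : ℝ) ^ Zcount (F := F) P p a g (σv σ) ((k.val : ℕ) : ZMod 3))
            ≤ 2 * ((2 : ℝ) ^ n * (3 / 2 : ℝ) ^ F) := by
        intro σ
        rw [sum_comm]
        have hk : ∀ k : Fin 3, ∑ a : Fin n → Bool,
            (if k = 0 then (0 : ℝ) else (2 : ℝ) ^ Zcount (F := F) P p a g (σv σ) ((k.val : ℕ) : ZMod 3))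
              ≤ (if k = 0 then (0 : ℝ) else (2 : ℝ) ^ n * (3 / 2 : ℝ) ^ F) := by
          intro k
          by_cases hk0 : k = 0
          · simp [hk0]
          · simp only [hk0, if_false]
            have hkz : ((k.val : ℕ) : ZMod 3) ≠ 0 := by
              have : k = 1 ∨ k = 2 := by omega
              rcases this with rfl | rfl <;> decide
            exact resonance_poly hord hqF P hIA g (σv σ) _ (σv_ne_zero σ) hkz
        calc _ ≤ ∑ k : Fin 3, (if k = 0 then (0 : ℝ) else (2 : ℝ) ^ n * (3 / 2 : ℝ) ^ F) := sum_le_sum fun k _ => hk k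
          _ = 2 * ((2 : ℝ) ^ n * (3 / 2 : ℝ) ^ F) := by rw [Fin.sum_univ_three]; simp; ring
      calc _ ≤ ∑ σ : Bool, 2 * ((2 : ℝ) ^ n * (3 / 2 : ℝ) ^ F) := sum_le_sum fun σ _ => hσ σ
        _ = _ := by rw [Fintype.sum_bool]; ring
    calc _ ≤ ∑ g : Fin (n + 1), 4 * ((2 : ℝ) ^ n * (3 / 2 : ℝ) ^ F) := sum_le_sum fun g _ => hg g
      _ = _ := by rw [sum_const, card_univ, Fintype.card_fin]; ring
  have hBadR : (Bad.card : ℝ) * ((2 : ℝ) ^ F - C) ≤ 4 * (n + 1) * ((2 : ℝ) ^ n * (3 / 2 : ℝ) ^ F) := by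
    have h1 : ∀ a ∈ Bad, ((2 : ℝ) ^ F - C) ≤ T a := by
      intro a ha
      rw [hBad, mem_filter, not_lt] at ha
      have h2 : ((2 ^ F : ℕ) : ℝ) ≤ (massN a : ℝ) := by exact_mod_cast ha.2
      push_cast at h2
      linarith [hmass a]
    have hTnn : ∀ a, 0 ≤ T a := by
      intro a; rw [hT]
      exact sum_nonneg fun g _ => sum_nonneg fun σ _ => sum_nonneg fun k _ => by split_ifs <;> positivity
    calc (Bad.card : ℝ) * ((2 : ℝ) ^ F - C) = ∑ a ∈ Bad, ((2 : ℝ) ^ F - C) := by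
          rw [sum_const, nsmul_eq_mul]
      _ ≤ ∑ a ∈ Bad, T a := sum_le_sum h1
      _ ≤ ∑ a, T a := sum_le_sum_of_subset_of_nonneg (subset_univ _) fun a _ _ => hTnn a
      _ ≤ _ := hTsum
  -- Step D: the numbers
  have hC2 : 2 * (C : ℝ) ≤ (2 : ℝ) ^ F := by
    have h : 2 * C ≤ 2 ^ F := by
      calc 2 * C = 4 * (n + 1) * (1 + 8 * F) := by rw [hC]; ring
        _ ≤ 2 ^ F := h2C
    exact_mod_cast h
  have h34 : 16 * ((n : ℝ) + 1) * (3 : ℝ) ^ F ≤ (4 : ℝ) ^ F := by exact_mod_cast h34N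
  have hBadle : (Bad.card : ℝ) ≤ (2 : ℝ) ^ n / 2 := by
    have hpos2 : (0 : ℝ) < (2 : ℝ) ^ F := by positivity
    have hCnn : (0 : ℝ) ≤ C := by positivity
    -- Bad · 2^Fn / 2 ≤ Bad · (2^Fn − C) ≤ 4(n+1) 2^n (3/2)^Fn
    have h1 : (Bad.card : ℝ) * ((2 : ℝ) ^ F / 2) ≤ 4 * (n + 1) * ((2 : ℝ) ^ n * (3 / 2 : ℝ) ^ F) := by
      have hb : (0 : ℝ) ≤ Bad.card := by positivity
      calc (Bad.card : ℝ) * ((2 : ℝ) ^ F / 2) ≤ (Bad.card : ℝ) * ((2 : ℝ) ^ F - C) :=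
            mul_le_mul_of_nonneg_left (by linarith) hb
        _ ≤ _ := hBadR
    have h32 : (3 / 2 : ℝ) ^ F * (2 : ℝ) ^ F = (3 : ℝ) ^ F := by
      rw [← mul_pow]; norm_num
    have h42 : (4 : ℝ) ^ F = (2 : ℝ) ^ F * (2 : ℝ) ^ F := by
      rw [← mul_pow]; norm_num
    -- divide through by `p = 2^{Fn}`
    have key : (16 * ((n : ℝ) + 1) * (3 / 2 : ℝ) ^ F) * (2 : ℝ) ^ F ≤ (2 : ℝ) ^ F * (2 : ℝ) ^ F := by
      calc (16 * ((n : ℝ) + 1) * (3 / 2 : ℝ) ^ F) * (2 : ℝ) ^ F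
          = 16 * ((n : ℝ) + 1) * ((3 / 2 : ℝ) ^ F * (2 : ℝ) ^ F) := by ring
        _ = 16 * ((n : ℝ) + 1) * (3 : ℝ) ^ F := by rw [h32]
        _ ≤ (4 : ℝ) ^ F := h34
        _ = (2 : ℝ) ^ F * (2 : ℝ) ^ F := h42
    have h34' : 16 * ((n : ℝ) + 1) * (3 / 2 : ℝ) ^ F ≤ (2 : ℝ) ^ F := le_of_mul_le_mul_right key hpos2
    have h2 : (Bad.card : ℝ) * ((2 : ℝ) ^ F / 2) ≤ ((2 : ℝ) ^ n / 2) * ((2 : ℝ) ^ F / 2) :=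
      h1.trans (by
        calc 4 * ((n : ℝ) + 1) * ((2 : ℝ) ^ n * (3 / 2 : ℝ) ^ F)
            = ((2 : ℝ) ^ n / 4) * (16 * ((n : ℝ) + 1) * (3 / 2 : ℝ) ^ F) := by ring
          _ ≤ ((2 : ℝ) ^ n / 4) * (2 : ℝ) ^ F := mul_le_mul_of_nonneg_left h34' (by positivity)
          _ = ((2 : ℝ) ^ n / 2) * ((2 : ℝ) ^ F / 2) := by ring)
    exact le_of_mul_le_mul_right h2 (by positivity)
  -- Step E: conclude
  have hGoodR : (2 : ℝ) ^ n / 2 ≤ Good.card := by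
    have h : ((Good.card + Bad.card : ℕ) : ℝ) = (2 : ℝ) ^ n := by rw [hGB]; push_cast; ring
    push_cast at h
    linarith
  have hLosR : (2 : ℝ) ^ n / 2 ≤ (2 : ℝ) ^ L (K + 1) * Los.card := by
    have h : (Good.card : ℝ) ≤ ((2 ^ L (K + 1) * Los.card : ℕ) : ℝ) := by exact_mod_cast hB
    push_cast at h
    linarith
  have hWR : ((univ.filter fun u : Fin n → Bool => Wn P u = true).card : ℝ) = (2 : ℝ) ^ n - Los.card := by
    have h : (((univ.filter fun u : Fin n → Bool => Wn P u = true).card + Los.card : ℕ) : ℝ) = (2 : ℝ) ^ n := by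
      rw [hWL]; push_cast; ring
    push_cast at h
    linarith
  have hpowL : (0 : ℝ) < (2 : ℝ) ^ L (K + 1) := by positivity
  calc (((univ.filter fun x : Fin (n + 1) → Bool => OddZeros x ∧ Rel x (zOf P x)).card : ℕ) : ℝ)
      ≤ ((univ.filter fun u : Fin n → Bool => Wn P u = true).card : ℝ) := by exact_mod_cast hS1
    _ = (2 : ℝ) ^ n - Los.card := hWR
    _ ≤ (2 : ℝ) ^ n - (2 : ℝ) ^ n / (2 * (2 : ℝ) ^ L (K + 1)) := by
        have : (2 : ℝ) ^ n / (2 * (2 : ℝ) ^ L (K + 1)) ≤ Los.card := by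
          rw [div_le_iff₀ (by positivity)]
          calc (2 : ℝ) ^ n = 2 * ((2 : ℝ) ^ n / 2) := by ring
            _ ≤ 2 * ((2 : ℝ) ^ L (K + 1) * Los.card) := by linarith
            _ = (Los.card : ℝ) * (2 * (2 : ℝ) ^ L (K + 1)) := by ring
        linarith



end Slicing

end Summit.QuantumAdvantage.AdviceFreeQNC0.NPGamma37Proof
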